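import Literature.Analysis.TotalPositivity.JacobiSturmTP2

/-!
# Discrete Sturm comparison for NON-SYMMETRIC (reversible) tilted Jacobi matrices ⇒ MLR ⇒ weighted TP₂

Generalisation of `Literature/Analysis/TotalPositivity/JacobiSturmTP2.lean` from symmetric Jacobi
matrices to birth–death (reversible tridiagonal) operators, the form in which LUMPED quantum
Hamiltonians arise: on the sites `1, …, n`,

  `lo(k) ψ(k−1) + b(k) ψ(k) + up(k) ψ(k+1) = (s V(k) − E) ψ(k)`,  `ψ(0) = ψ(n+1) = 0`,

with positive couplings `up(k)` (`k → k+1`), `lo(k+1)` (`k+1 → k`) and DETAILED-BALANCE weights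
`π(k) > 0`, `π(k) up(k) = π(k+1) lo(k+1)` (every such operator is symmetric in `ℓ²(π)`).  With the
weighted discrete Wronskian `W(k) = π(k) up(k) (ψ(k)φ(k+1) − ψ(k+1)φ(k))`:

* `bd_wronskian_eq_sum` — `W(k) = Σ_{j ≤ k} π(j)ψ(j)φ(j)((t−s)V(j) − (E_t − E_s))` for eigenvectors at
  tilts `s, t`;
* `bd_mlr` — **Sturm ⇒ MLR**: `V` non-decreasing, `s ≤ t`, `ψ, φ > 0` ⇒ `ψ(k)φ(k+1) ≤ ψ(k+1)φ(k)`;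
  `bd_mlr_pairs` — all pairs `k ≤ l`;
* `gram_tp2_weighted_of_mlr` — two MLR-ordered pairs of positive vectors have a TP₂ WEIGHTED
  overlap kernel `Σ_k w(k) ψᵢ(k) φⱼ(k)` (`w ≥ 0`), by `gram_tp2_of_sameSign`;
* `bd_gramTP2` — **monotone tilt ⇒ TP₂ of the `ℓ²(w)` overlap kernel** of positive Dirichlet
  eigenvectors at tilts `s₁ ≤ s₂`, `t₁ ≤ t₂`, for any non-negative weight `w`.

References: F. Gantmacher, M. Krein, *Oscillation Matrices and Kernels…* (AMS Chelsea 2002), Ch. II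
§1 (Jacobi matrices; a sign-symmetric tridiagonal matrix is diagonally similar to a symmetric one);
S. Karlin, *Total Positivity* I (1968), Ch. 3.  Theory seat `hubbard-h0-rotor-theory-1`, memo
ROTOR-THEORY-6 §61 (exact lumping of XXZ sectors to birth–death chains).  No definition is introduced.
-/

namespace Literature.Analysis.TotalPositivity

/-- Partial sums of `p_j g_j` with `p_j ≥ 0`, `g` non-decreasing on `[1, n]` and total `0` are
non-positive (private helper, as in `JacobiSturmTP2`). [folklore] -/
private theorem partialSum_nonpos_of_monotone' {n : ℕ} (p g : ℕ → ℝ)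
    (hp : ∀ j, 1 ≤ j → j ≤ n → 0 ≤ p j)
    (hg : ∀ i j, 1 ≤ i → i ≤ j → j ≤ n → g i ≤ g j)
    (htot : ∑ j ∈ Finset.Icc 1 n, p j * g j = 0) (k : ℕ) (hk : k ≤ n) :
    ∑ j ∈ Finset.Icc 1 k, p j * g j ≤ 0 := by
  by_cases hneg : ∀ j, 1 ≤ j → j ≤ k → g j ≤ 0
  · apply Finset.sum_nonpos
    intro j hj
    rw [Finset.mem_Icc] at hj
    exact mul_nonpos_of_nonneg_of_nonpos (hp j hj.1 (hj.2.trans hk)) (hneg j hj.1 hj.2)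
  · push Not at hneg
    obtain ⟨j₀, hj1, hjk, hgpos⟩ := hneg
    have hsplit : ∑ j ∈ Finset.Icc 1 n, p j * g j
        = ∑ j ∈ Finset.Icc 1 k, p j * g j + ∑ j ∈ Finset.Ioc k n, p j * g j := by
      rw [← Finset.sum_union]
      · congr 1
        ext j; simp only [Finset.mem_Icc, Finset.mem_union, Finset.mem_Ioc]; omega
      · rw [Finset.disjoint_left]; intro j h1 h2
        simp only [Finset.mem_Icc, Finset.mem_Ioc] at h1 h2; omega
    have htail : 0 ≤ ∑ j ∈ Finset.Ioc k n, p j * g j := by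
      apply Finset.sum_nonneg
      intro j hj; rw [Finset.mem_Ioc] at hj
      have : 0 ≤ g j := hgpos.le.trans (hg j₀ j hj1 (by omega) hj.2)
      exact mul_nonneg (hp j (by omega) hj.2) this
    linarith

variable {n : ℕ} {up lo b V w π ψ φ : ℕ → ℝ} {s t Es Et : ℝ}

/-- **Weighted Wronskian as a partial sum.**  For eigenvectors `ψ` (tilt `s`, energy `Es`) and `φ`
(tilt `t`, energy `Et`) of the reversible tridiagonal operator
`lo(k)f(k−1) + b(k)f(k) + up(k)f(k+1)`, Dirichlet at `0`, detailed-balance weights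
`π(k)up(k) = π(k+1)lo(k+1)`:
`π(k)up(k)(ψ(k)φ(k+1) − ψ(k+1)φ(k)) = Σ_{j=1}^{k} π(j)ψ(j)φ(j)((t−s)V(j) − (Et−Es))`, `k ≤ n`.
[cite: GantmacherKrein2002, Ch. II §1 (Jacobi matrices)] -/
theorem bd_wronskian_eq_sum
    (hbal : ∀ k, 1 ≤ k → k < n → π k * up k = π (k + 1) * lo (k + 1))
    (hψ0 : ψ 0 = 0) (hφ0 : φ 0 = 0)
    (hψ : ∀ k, 1 ≤ k → k ≤ n → lo k * ψ (k - 1) + b k * ψ k + up k * ψ (k + 1) = (s * V k - Es) * ψ k)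
    (hφ : ∀ k, 1 ≤ k → k ≤ n → lo k * φ (k - 1) + b k * φ k + up k * φ (k + 1) = (t * V k - Et) * φ k)
    (k : ℕ) (hkn : k ≤ n) :
    π k * up k * (ψ k * φ (k + 1) - ψ (k + 1) * φ k) =
      ∑ j ∈ Finset.Icc 1 k, π j * ψ j * φ j * ((t - s) * V j - (Et - Es)) := by
  induction k with
  | zero => simp [hψ0, hφ0]
  | succ m ih =>
    rw [Finset.sum_Icc_succ_top (by omega)]
    have h1 := hψ (m + 1) (by omega) hkn
    have h2 := hφ (m + 1) (by omega) hkn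
    simp only [Nat.add_sub_cancel] at h1 h2
    rcases Nat.eq_zero_or_pos m with hm0 | hmpos
    · subst hm0
      have he : Finset.Icc 1 0 = (∅ : Finset ℕ) := Finset.Icc_eq_empty (by omega)
      rw [he, Finset.sum_empty, zero_add]
      simp only [zero_add] at h1 h2 ⊢
      rw [hψ0] at h1; rw [hφ0] at h2
      linear_combination (π 1 * ψ 1) * h2 - (π 1 * φ 1) * h1
    · have hb := hbal m hmpos (by omega)
      rw [← ih (by omega)]
      linear_combination (π (m + 1) * ψ (m + 1)) * h2 - (π (m + 1) * φ (m + 1)) * h1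
        + (ψ (m + 1) * φ m - ψ m * φ (m + 1)) * hb

/-- **DISCRETE STURM COMPARISON ⇒ MLR for reversible tridiagonal operators.**  Couplings
`up(k) > 0` (`1 ≤ k < n`), weights `π(k) > 0` with detailed balance, `V` NON-DECREASING, tilts
`s ≤ t`, positive Dirichlet eigenvectors `ψ` (tilt `s`) and `φ` (tilt `t`): `ψ(k)φ(k+1) ≤ ψ(k+1)φ(k)`
for `1 ≤ k < n` — the likelihood ratio `φ/ψ` is non-increasing along the chain.
[cite: GantmacherKrein2002, Ch. II (oscillation theorems for Jacobi matrices)] -/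
theorem bd_mlr (hup : ∀ k, 1 ≤ k → k < n → 0 < up k) (hπ : ∀ k, 1 ≤ k → k ≤ n → 0 < π k)
    (hbal : ∀ k, 1 ≤ k → k < n → π k * up k = π (k + 1) * lo (k + 1))
    (hV : ∀ i j, 1 ≤ i → i ≤ j → j ≤ n → V i ≤ V j) (hst : s ≤ t)
    (hψpos : ∀ k, 1 ≤ k → k ≤ n → 0 < ψ k) (hφpos : ∀ k, 1 ≤ k → k ≤ n → 0 < φ k)
    (hψ0 : ψ 0 = 0) (hφ0 : φ 0 = 0) (hψn : ψ (n + 1) = 0) (hφn : φ (n + 1) = 0)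
    (hψ : ∀ k, 1 ≤ k → k ≤ n → lo k * ψ (k - 1) + b k * ψ k + up k * ψ (k + 1) = (s * V k - Es) * ψ k)
    (hφ : ∀ k, 1 ≤ k → k ≤ n → lo k * φ (k - 1) + b k * φ k + up k * φ (k + 1) = (t * V k - Et) * φ k)
    (k : ℕ) (hk1 : 1 ≤ k) (hkn : k < n) :
    ψ k * φ (k + 1) ≤ ψ (k + 1) * φ k := by
  have hWn : π n * up n * (ψ n * φ (n + 1) - ψ (n + 1) * φ n) = 0 := by simp [hψn, hφn]
  have htot : ∑ j ∈ Finset.Icc 1 n, π j * ψ j * φ j * ((t - s) * V j - (Et - Es)) = 0 := by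
    rw [← bd_wronskian_eq_sum hbal hψ0 hφ0 hψ hφ n le_rfl, hWn]
  have hW : π k * up k * (ψ k * φ (k + 1) - ψ (k + 1) * φ k) ≤ 0 := by
    rw [bd_wronskian_eq_sum hbal hψ0 hφ0 hψ hφ k hkn.le]
    have := partialSum_nonpos_of_monotone' (n := n) (fun j => π j * ψ j * φ j)
      (fun j => (t - s) * V j - (Et - Es)) ?_ ?_ (by simpa [mul_assoc] using htot) k hkn.le
    · simpa [mul_assoc] using this
    · intro j hj1 hjn
      exact (mul_pos (mul_pos (hπ j hj1 hjn) (hψpos j hj1 hjn)) (hφpos j hj1 hjn)).le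
    · intro i j hi hij hjn
      have := hV i j hi hij hjn
      have hts : 0 ≤ t - s := sub_nonneg.2 hst
      nlinarith
  have hc : 0 < π k * up k := mul_pos (hπ k hk1 hkn.le) (hup k hk1 hkn)
  by_contra hcon
  push Not at hcon
  have : 0 < π k * up k * (ψ k * φ (k + 1) - ψ (k + 1) * φ k) := mul_pos hc (by linarith)
  linarith

/-- **MLR for all pairs** `1 ≤ k ≤ l ≤ n` (cross-multiplied): `ψ(k)φ(l) ≤ ψ(l)φ(k)`.
[cite: GantmacherKrein2002, Ch. II] -/
theorem bd_mlr_pairs (hup : ∀ k, 1 ≤ k → k < n → 0 < up k) (hπ : ∀ k, 1 ≤ k → k ≤ n → 0 < π k)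
    (hbal : ∀ k, 1 ≤ k → k < n → π k * up k = π (k + 1) * lo (k + 1))
    (hV : ∀ i j, 1 ≤ i → i ≤ j → j ≤ n → V i ≤ V j) (hst : s ≤ t)
    (hψpos : ∀ k, 1 ≤ k → k ≤ n → 0 < ψ k) (hφpos : ∀ k, 1 ≤ k → k ≤ n → 0 < φ k)
    (hψ0 : ψ 0 = 0) (hφ0 : φ 0 = 0) (hψn : ψ (n + 1) = 0) (hφn : φ (n + 1) = 0)
    (hψ : ∀ k, 1 ≤ k → k ≤ n → lo k * ψ (k - 1) + b k * ψ k + up k * ψ (k + 1) = (s * V k - Es) * ψ k)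
    (hφ : ∀ k, 1 ≤ k → k ≤ n → lo k * φ (k - 1) + b k * φ k + up k * φ (k + 1) = (t * V k - Et) * φ k)
    (k l : ℕ) (hk1 : 1 ≤ k) (hkl : k ≤ l) (hln : l ≤ n) :
    ψ k * φ l ≤ ψ l * φ k := by
  have key : ∀ m, k ≤ m → m ≤ n → φ m / ψ m ≤ φ k / ψ k := by
    intro m hkm hmn
    induction m, hkm using Nat.le_induction with
    | base => exact le_rfl
    | succ m hkm ih =>
      have hmn' : m < n := by omega
      have step := bd_mlr hup hπ hbal hV hst hψpos hφpos hψ0 hφ0 hψn hφn hψ hφ m (by omega) hmn'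
      have hψm := hψpos m (by omega) hmn'.le
      have hψm1 := hψpos (m + 1) (by omega) hmn
      have : φ (m + 1) / ψ (m + 1) ≤ φ m / ψ m := by
        rw [div_le_div_iff₀ hψm1 hψm]; linarith
      exact this.trans (ih hmn'.le)
  have hψk := hψpos k hk1 (hkl.trans hln)
  have hψl := hψpos l (by omega) hln
  have := key l hkl hln
  rw [div_le_div_iff₀ hψl hψk] at this
  linarith

/-- **Weighted Gram TP₂ from MLR**: if `ψ₂/ψ₁` and `φ₂/φ₁` are both non-increasing on `S`
(cross-multiplied: `ψ₁(k)ψ₂(l) ≤ ψ₁(l)ψ₂(k)`… in the same orientation for both pairs), then for every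
weight `w ≥ 0` the `ℓ²(w)` overlap kernel is TP₂:
`(Σ w ψ₁φ₂)(Σ w ψ₂φ₁) ≤ (Σ w ψ₁φ₁)(Σ w ψ₂φ₂)`. [cite: Karlin1968, Ch. 3 §1 (basic composition formula)] -/
theorem gram_tp2_weighted_of_mlr {ι : Type*} [LinearOrder ι] (S : Finset ι)
    (w ψ₁ ψ₂ φ₁ φ₂ : ι → ℝ) (hw : ∀ k ∈ S, 0 ≤ w k)
    (hψ : ∀ k ∈ S, ∀ l ∈ S, k ≤ l → ψ₁ k * ψ₂ l ≤ ψ₁ l * ψ₂ k)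
    (hφ : ∀ k ∈ S, ∀ l ∈ S, k ≤ l → φ₁ k * φ₂ l ≤ φ₁ l * φ₂ k) :
    (∑ k ∈ S, w k * ψ₁ k * φ₂ k) * (∑ k ∈ S, w k * ψ₂ k * φ₁ k) ≤
      (∑ k ∈ S, w k * ψ₁ k * φ₁ k) * (∑ k ∈ S, w k * ψ₂ k * φ₂ k) := by
  have h := gram_tp2_of_sameSign S (fun k => w k * ψ₁ k) (fun k => w k * ψ₂ k) φ₁ φ₂ ?_
  · simpa [mul_assoc] using h
  intro k hk l hl
  have hwkl : 0 ≤ w k * w l := mul_nonneg (hw k hk) (hw l hl)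
  have e : (w k * ψ₁ k * (w l * ψ₂ l) - w l * ψ₁ l * (w k * ψ₂ k)) * (φ₁ k * φ₂ l - φ₁ l * φ₂ k) =
      (w k * w l) * ((ψ₁ k * ψ₂ l - ψ₁ l * ψ₂ k) * (φ₁ k * φ₂ l - φ₁ l * φ₂ k)) := by ring
  rw [e]
  refine mul_nonneg hwkl ?_
  rcases le_total k l with hkl | hlk
  · exact mul_nonneg_of_nonpos_of_nonpos (by linarith [hψ k hk l hl hkl]) (by linarith [hφ k hk l hl hkl])
  · exact mul_nonneg (by linarith [hψ l hl k hk hlk]) (by linarith [hφ l hl k hk hlk])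

/-- **THEOREM (monotone tilt of a reversible tridiagonal operator ⇒ TP₂ weighted overlap kernel).**
Positive Dirichlet eigenvectors `ψ₁, ψ₂` at tilts `s₁ ≤ s₂` and `φ₁, φ₂` at tilts `t₁ ≤ t₂` of
`lo(k)f(k−1) + b(k)f(k) + up(k)f(k+1) − sV(k)f(k)` (`V` non-decreasing, detailed-balance weights `π`)
satisfy, for every weight `w ≥ 0` on `1..n`,
`(Σ w ψ₁φ₂)(Σ w ψ₂φ₁) ≤ (Σ w ψ₁φ₁)(Σ w ψ₂φ₂)`.  The lumped form of THEOREM 1D of the theory seat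
(memo ROTOR-THEORY-6 §61). [cite: Karlin1968, Ch. 3 §1; GantmacherKrein2002, Ch. II] -/
theorem bd_gramTP2 (hup : ∀ k, 1 ≤ k → k < n → 0 < up k) (hπ : ∀ k, 1 ≤ k → k ≤ n → 0 < π k)
    (hbal : ∀ k, 1 ≤ k → k < n → π k * up k = π (k + 1) * lo (k + 1))
    (hV : ∀ i j, 1 ≤ i → i ≤ j → j ≤ n → V i ≤ V j) (hw : ∀ k, 1 ≤ k → k ≤ n → 0 ≤ w k)
    {s₁ s₂ t₁ t₂ E₁ E₂ F₁ F₂ : ℝ} (hs : s₁ ≤ s₂) (ht : t₁ ≤ t₂)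
    {ψ₁ ψ₂ φ₁ φ₂ : ℕ → ℝ}
    (pψ₁ : ∀ k, 1 ≤ k → k ≤ n → 0 < ψ₁ k) (pψ₂ : ∀ k, 1 ≤ k → k ≤ n → 0 < ψ₂ k)
    (pφ₁ : ∀ k, 1 ≤ k → k ≤ n → 0 < φ₁ k) (pφ₂ : ∀ k, 1 ≤ k → k ≤ n → 0 < φ₂ k)
    (zψ₁ : ψ₁ 0 = 0 ∧ ψ₁ (n + 1) = 0) (zψ₂ : ψ₂ 0 = 0 ∧ ψ₂ (n + 1) = 0)
    (zφ₁ : φ₁ 0 = 0 ∧ φ₁ (n + 1) = 0) (zφ₂ : φ₂ 0 = 0 ∧ φ₂ (n + 1) = 0)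
    (eψ₁ : ∀ k, 1 ≤ k → k ≤ n →
      lo k * ψ₁ (k - 1) + b k * ψ₁ k + up k * ψ₁ (k + 1) = (s₁ * V k - E₁) * ψ₁ k)
    (eψ₂ : ∀ k, 1 ≤ k → k ≤ n →
      lo k * ψ₂ (k - 1) + b k * ψ₂ k + up k * ψ₂ (k + 1) = (s₂ * V k - E₂) * ψ₂ k)
    (eφ₁ : ∀ k, 1 ≤ k → k ≤ n →
      lo k * φ₁ (k - 1) + b k * φ₁ k + up k * φ₁ (k + 1) = (t₁ * V k - F₁) * φ₁ k)
    (eφ₂ : ∀ k, 1 ≤ k → k ≤ n →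
      lo k * φ₂ (k - 1) + b k * φ₂ k + up k * φ₂ (k + 1) = (t₂ * V k - F₂) * φ₂ k) :
    (∑ k ∈ Finset.Icc 1 n, w k * ψ₁ k * φ₂ k) * (∑ k ∈ Finset.Icc 1 n, w k * ψ₂ k * φ₁ k)
      ≤ (∑ k ∈ Finset.Icc 1 n, w k * ψ₁ k * φ₁ k) * (∑ k ∈ Finset.Icc 1 n, w k * ψ₂ k * φ₂ k) := by
  refine gram_tp2_weighted_of_mlr (Finset.Icc 1 n) w ψ₁ ψ₂ φ₁ φ₂
    (fun k hk => by rw [Finset.mem_Icc] at hk; exact hw k hk.1 hk.2) ?_ ?_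
  · intro k hk l hl hkl
    rw [Finset.mem_Icc] at hk hl
    exact bd_mlr_pairs hup hπ hbal hV hs pψ₁ pψ₂ zψ₁.1 zψ₂.1 zψ₁.2 zψ₂.2 eψ₁ eψ₂ k l hk.1 hkl hl.2
  · intro k hk l hl hkl
    rw [Finset.mem_Icc] at hk hl
    exact bd_mlr_pairs hup hπ hbal hV ht pφ₁ pφ₂ zφ₁.1 zφ₂.1 zφ₁.2 zφ₂.2 eφ₁ eφ₂ k l hk.1 hkl hl.2

end Literature.Analysis.TotalPositivity
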